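import Literature.Topology.FourManifolds.HandleAttachingMapsLocality
import Literature.Topology.FourManifolds.HandleAttachingMapsUniqueness
import Literature.Topology.FourManifolds.HandleAttachingMapsProofs
import Literature.Topology.FourManifolds.ClosedBallProofs
import HarnessLib

/-!
# Re-association of handle attachments: `(M ∪ H ∪ ⋯ ∪ H) ∪ H = M ∪ (H ∪ ⋯ ∪ H ∪ H)`

Topic `Literature/Topology/FourManifolds`; a proofs-and-plumbing file below
`HandleAttachingMaps.lean` (Kosinski's attaching maps `h̄ : T → M`, the relational attachments
`HandleAttachingMap.IsAttachment` and `HandleAttachingMap.IsMultiAttachment`), in the style of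
`HandleAttachingMapsUniqueness.lean`, `…Transport.lean`, `…Locality.lean`.

Kosinski, *Differential Manifolds* (1993), VI §6–7 attaches handles one at a time,
`M₁ = M ∪ H^λ`, `M₂ = M₁ ∪ H^λ`, …, and remarks (VI (7.1); VII, proof of (1.2): *"since they are
all of the same index they can all be attached 'at the same time'"*) that handles attached along
disjoint attaching maps into `∂M` may be attached simultaneously.  The tree's simultaneous
attachment `IsMultiAttachment h IP P` (one copy of `Dᵐ ∖ S` per handle, glued to
`M ∖ ⋃ᵢ h̄ᵢ(S)`) is the form in which presentation handlebodies (`PresentationHandlebodyFive`)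
and Kirby diagrams are phrased, while every *move* on one handle among several (a slide over
another handle, a birth or a death of a cancelling pair, an isotopy across another handle)
takes place in the manifold `M ∪ (the other handles)`.  This file provides the passage:

* `HandleAttachingMap.MultiAttachmentData h IP P` — the witnesses of `IsMultiAttachment h IP P`
  as a structure (`isMultiAttachment_iff_nonempty_multiAttachmentData`);
* `MultiAttachmentData.lift D g hg : HandleAttachingMap n k P₁` — **an attaching map `ḡ : T → M`
  whose range misses the ranges of the `h̄ᵢ` is an attaching map of `P₁ = M ∪_{h̄} (handles)`**,
  namely `jA ∘ ḡ` (`jA` the embedding of `M ∖ ⋃ h̄ᵢ(S)`): a smooth embedding with open range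
  (immersions pass to codomain restrictions and open embeddings), taking `T ∩ ∂Dᵐ` into `∂P₁`
  (open smooth embeddings and open submanifolds preserve boundary points,
  `mem_boundary_iff_of_isSmoothEmbedding`, `mem_boundary_opens_iff`);
* `MultiAttachmentData.isMultiAttachment_cons` — **if `P` is `P₁` with one more handle attached
  along `jA ∘ ḡ`, then `P` is `M` with all the handles attached simultaneously** along the
  family `Option.elim · g h` (`none ↦ ḡ`, `some i ↦ h̄ᵢ`).  The new cover of `P`: the `M`-piece
  `M ∖ (ḡ(S) ∪ ⋃ h̄ᵢ(S))` embedded by `jA' ∘ jA`, the old handles by `jA' ∘ jBᵢ` (they miss the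
  new attaching sphere `jA(ḡ(S))`, whose points are glued to nothing), the new handle by `jB'`;
  the gluing relations are read through the injective `jA'`, `jA`.

* `MultiAttachmentData.isAttachment_lift_of_isMultiAttachment_cons` — **the converse**: if `P`
  is `M` with the handles `(ḡ, h̄ᵢ)ᵢ` attached simultaneously, then `P` is `P₁` with one handle
  attached along `jA ∘ ḡ` — from the direct passage by existence
  (`HandleAttachingMap.exists_isAttachment_holds`) and uniqueness
  (`IsMultiAttachment.nonempty_diffeomorph`) of attachments, and transport of attachments
  along diffeomorphisms of the attached manifold (`IsAttachment.of_diffeomorph`).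

Everything here is proved; no named facts are introduced (D-0026).

## References

* A. A. Kosinski, *Differential Manifolds*, Academic Press (1993), VI §6 (`M ∪ H^λ`), (7.1),
  VII proof of (1.2) ("attached at the same time"). [Kosinski1993]
* R. C. Kirby, *The Topology of 4-Manifolds*, LNM 1374 (1989), Ch. I §1 (`M_i = M_{i-1} ∪ h`).
  [Kirby1989]
-/

open scoped Manifold ContDiff Topology
open Set Function Metric Filter

noncomputable section

namespace Literature.Topology.FourManifolds

universe u

/-- Local notation: `𝔼 n` is the model Euclidean space `EuclideanSpace ℝ (Fin n)`. -/
local notation "𝔼 " n:arg => EuclideanSpace ℝ (Fin n)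

/-- Local notation: `𝔻 n` is the closed unit ball in `EuclideanSpace ℝ (Fin n)`. -/
local notation "𝔻 " n:arg => (Metric.closedBall (0 : EuclideanSpace ℝ (Fin n)) 1)

namespace HandleAttachingMap

variable {n k : ℕ} {M : Type u} [TopologicalSpace M] [T2Space M]
  [ChartedSpace (EuclideanHalfSpace (n + 1)) M]
  {ι : Type*} [Finite ι] {h : ι → HandleAttachingMap n k M}

/-! ### The witnesses of a multi-attachment -/

/-- **The data of a simultaneous attachment of handles** along the family `h̄ᵢ`: the clauses of
`HandleAttachingMap.IsMultiAttachment h IP P` — the embedding `jA` of `M ∖ ⋃ᵢ h̄ᵢ(S)`, the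
handle embeddings `jBᵢ : Dᵐ ∖ S → P`, covering `P`, meeting along Kosinski's identification
`x ∼ h̄ᵢ α(x)` and pairwise disjoint — as a structure, so that constructions depending on the
identification (such as `MultiAttachmentData.lift`) can be named.
[cite: Kosinski1993, VI §6] -/
structure MultiAttachmentData (h : ι → HandleAttachingMap n k M)
    {EP HP : Type*} [NormedAddCommGroup EP] [NormedSpace ℝ EP] [TopologicalSpace HP]
    (IP : ModelWithCorners ℝ EP HP) (P : Type*) [TopologicalSpace P] [ChartedSpace HP P] where
  /-- the `h̄ᵢ` have pairwise disjoint ranges -/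
  disjoint : Pairwise fun i j => Disjoint (range (h i).toFun) (range (h j).toFun)
  /-- the embedding of `M ∖ ⋃ h̄ᵢ(S)` -/
  jA : ↥(coresComplement h) → P
  /-- the handle embeddings -/
  jB : ι → ↥(beltPiece n k) → P
  /-- `jA` is a smooth embedding … -/
  hjA : Manifold.IsSmoothEmbedding (𝓡∂ (n + 1)) IP ∞ jA
  /-- … with open range -/
  hjAo : IsOpen (range jA)
  /-- the `jBᵢ` are smooth embeddings with open ranges -/
  hjB : ∀ i, Manifold.IsSmoothEmbedding (𝓡∂ (n + 1)) IP ∞ (jB i) ∧ IsOpen (range (jB i))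
  /-- the pieces cover `P` -/
  cover : range jA ∪ (⋃ i, range (jB i)) = univ
  /-- the pieces meet along Kosinski's gluing relation -/
  glue : ∀ i a b, jA a = jB i b ↔ (h i).glueRel (a : M) (b : 𝔻 (n + 1))
  /-- the handles are pairwise disjoint -/
  disjointB : Pairwise fun i j => Disjoint (range (jB i)) (range (jB j))

section Data

variable {EP HP : Type*} [NormedAddCommGroup EP] [NormedSpace ℝ EP] [TopologicalSpace HP]
  {IP : ModelWithCorners ℝ EP HP} {P : Type*} [TopologicalSpace P] [ChartedSpace HP P]

/-- Data of a multi-attachment give a multi-attachment. [folklore] -/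
theorem MultiAttachmentData.isMultiAttachment (D : MultiAttachmentData h IP P) :
    IsMultiAttachment h IP P :=
  ⟨D.disjoint, D.jA, D.jB, D.hjA, D.hjAo, D.hjB, D.cover, D.glue, D.disjointB⟩

/-- A multi-attachment has data. [folklore] -/
theorem IsMultiAttachment.nonempty_multiAttachmentData (hP : IsMultiAttachment h IP P) :
    Nonempty (MultiAttachmentData h IP P) := by
  obtain ⟨hdisj, jA, jB, hjA, hjAo, hjB, hcov, hglue, hdisjB⟩ := hP
  exact ⟨{ disjoint := hdisj, jA := jA, jB := jB, hjA := hjA, hjAo := hjAo, hjB := hjB,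
           cover := hcov, glue := hglue, disjointB := hdisjB }⟩

/-- `IsMultiAttachment` is the existence of `MultiAttachmentData`. [folklore] -/
theorem isMultiAttachment_iff_nonempty_multiAttachmentData :
    IsMultiAttachment h IP P ↔ Nonempty (MultiAttachmentData h IP P) :=
  ⟨IsMultiAttachment.nonempty_multiAttachmentData, fun ⟨D⟩ => D.isMultiAttachment⟩

/-- A choice of data for a multi-attachment. [folklore] -/
def IsMultiAttachment.multiAttachmentData (hP : IsMultiAttachment h IP P) :
    MultiAttachmentData h IP P :=
  Classical.choice hP.nonempty_multiAttachmentData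

namespace MultiAttachmentData

/-- `jA` is injective. [folklore] -/
theorem injective_jA (D : MultiAttachmentData h IP P) : Injective D.jA :=
  D.hjA.isEmbedding.injective

/-- The `jBᵢ` are injective. [folklore] -/
theorem injective_jB (D : MultiAttachmentData h IP P) (i : ι) : Injective (D.jB i) :=
  (D.hjB i).1.isEmbedding.injective

/-- `jA` is an open map. [folklore] -/
theorem isOpenMap_jA (D : MultiAttachmentData h IP P) : IsOpenMap D.jA :=
  (Topology.IsOpenEmbedding.mk D.hjA.isEmbedding D.hjAo).isOpenMap

/-- The `jBᵢ` are open maps. [folklore] -/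
theorem isOpenMap_jB (D : MultiAttachmentData h IP P) (i : ι) : IsOpenMap (D.jB i) :=
  (Topology.IsOpenEmbedding.mk (D.hjB i).1.isEmbedding (D.hjB i).2).isOpenMap

/-- Every point of `P` is in the `M`-piece or in a handle. [folklore] -/
theorem mem_range_or (D : MultiAttachmentData h IP P) (p : P) :
    (∃ a, D.jA a = p) ∨ ∃ i b, D.jB i b = p := by
  have hp := (eq_univ_iff_forall.1 D.cover) p
  simp only [mem_union, mem_range, mem_iUnion] at hp
  exact hp

end MultiAttachmentData

end Data

/-! ### An attaching map disjoint from the family is an attaching map of `M ∪_{h̄} (handles)` -/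

section Lift

variable [IsManifold (𝓡∂ (n + 1)) ∞ M]
  {P₁ : Type*} [TopologicalSpace P₁] [ChartedSpace (EuclideanHalfSpace (n + 1)) P₁]
  [IsManifold (𝓡∂ (n + 1)) ∞ P₁]

omit [IsManifold (𝓡∂ (n + 1)) ∞ M] in
/-- A point in the range of an attaching map `ḡ` whose range misses the ranges of the `h̄ᵢ`
lies off all the attaching spheres `h̄ᵢ(S)`. [folklore] -/
theorem apply_mem_coresComplement_of_disjoint {g : HandleAttachingMap n k M}
    (hg : ∀ i, Disjoint (range g.toFun) (range (h i).toFun)) (y : ↥(handleTube n k)) :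
    g.toFun y ∈ coresComplement h := by
  rw [mem_coresComplement]
  rintro i ⟨y', -, he⟩
  exact Set.disjoint_left.1 (hg i) (mem_range_self y) (by rw [← he]; exact mem_range_self y')

section LiftPt

variable (g : HandleAttachingMap n k M) (hg : ∀ i, Disjoint (range g.toFun) (range (h i).toFun))

omit [IsManifold (𝓡∂ (n + 1)) ∞ M] in
/-- The point `ḡ(y)` as a point of `M ∖ ⋃ h̄ᵢ(S)`, for an attaching map `ḡ` whose range misses
the ranges of the `h̄ᵢ`. [folklore] -/
def liftPt (y : ↥(handleTube n k)) : ↥(coresComplement h) :=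
  ⟨g.toFun y, apply_mem_coresComplement_of_disjoint hg y⟩

omit [IsManifold (𝓡∂ (n + 1)) ∞ M] in
/-- The underlying point of `liftPt`. [folklore] -/
@[simp] theorem coe_liftPt (y : ↥(handleTube n k)) : (liftPt g hg y : M) = g.toFun y := rfl

omit [IsManifold (𝓡∂ (n + 1)) ∞ M] in
/-- `liftPt` is injective. [folklore] -/
theorem injective_liftPt : Injective (liftPt g hg) := fun _ _ e =>
  g.injective (congrArg Subtype.val e)

omit [IsManifold (𝓡∂ (n + 1)) ∞ M] in
/-- `liftPt` is a topological embedding (codomain restriction of the embedding `ḡ`). [folklore] -/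
theorem isEmbedding_liftPt : Topology.IsEmbedding (liftPt g hg) :=
  Topology.IsEmbedding.of_comp (g.continuous.subtype_mk _) continuous_subtype_val
    g.isSmoothEmbedding.isEmbedding

omit [IsManifold (𝓡∂ (n + 1)) ∞ M] in
/-- The range of `liftPt` is open (the trace of the open range of `ḡ`). [folklore] -/
theorem isOpen_range_liftPt : IsOpen (range (liftPt g hg)) := by
  have : range (liftPt g hg) = Subtype.val ⁻¹' range g.toFun := by
    ext a
    constructor
    · rintro ⟨y, rfl⟩; exact ⟨y, rfl⟩
    · rintro ⟨y, hy⟩; exact ⟨y, Subtype.ext hy⟩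
  rw [this]
  exact g.isOpen_range.preimage continuous_subtype_val

end LiftPt

namespace MultiAttachmentData

variable (D : MultiAttachmentData h (𝓡∂ (n + 1)) P₁) (g : HandleAttachingMap n k M)
  (hg : ∀ i, Disjoint (range g.toFun) (range (h i).toFun))

/-- `liftPt` is an immersion at every point, for any complement of the right dimension (here
the trivial one): the codomain restriction of the immersion `ḡ` to the open
`M ∖ ⋃ h̄ᵢ(S)`. [folklore] -/
theorem isImmersionAt_jA_comp_liftPt (y : ↥(handleTube n k)) :
    Manifold.IsImmersionAt (𝓡∂ (n + 1)) (𝓡∂ (n + 1)) ∞ (D.jA ∘ liftPt g hg) y := by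
  obtain ⟨F, _, _, hF⟩ := g.isSmoothEmbedding.isImmersion
  have h1 : Manifold.IsImmersionAtOfComplement F (𝓡∂ (n + 1)) (𝓡∂ (n + 1)) ∞
      (liftPt g hg) y :=
    (hF y).codRestrict_opens (coresComplement h) (apply_mem_coresComplement_of_disjoint hg)
  exact (h1.openEmbedding_comp D.hjA D.hjAo).isImmersionAt

/-- **The lifted attaching map `jA ∘ ḡ : T → P₁`**: an attaching map `ḡ` of `M` whose range
misses the ranges of the `h̄ᵢ` is an attaching map of `P₁ = M ∪_{h̄} (handles)` — a smooth
embedding (immersion at every point by `isImmersionAt_jA_comp_liftPt`, embedding as a composite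
of embeddings) with open range (`jA` is open), sending `T ∩ ∂Dᵐ` into `∂P₁` (`ḡ` sends it into
`∂M`, and the open submanifold `M ∖ ⋃ h̄ᵢ(S)` and the open embedding `jA` preserve boundary
points).  Kosinski VI §7: the next handle is attached to `M₁ = M ∪ H^λ` along a map into
`∂M₁` off the first handle. [cite: Kosinski1993, VI §6–7] -/
def lift : HandleAttachingMap n k P₁ where
  toFun := D.jA ∘ liftPt g hg
  isSmoothEmbedding :=
    ⟨Manifold.isImmersion_of_isImmersionAt_of_finrank_eq rfl (D.isImmersionAt_jA_comp_liftPt g hg),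
      D.hjA.isEmbedding.comp (isEmbedding_liftPt g hg)⟩
  isOpen_range := by
    rw [range_comp]
    exact D.isOpenMap_jA _ (isOpen_range_liftPt g hg)
  isBoundaryPoint y hy := by
    have h1 : g.toFun y ∈ (𝓡∂ (n + 1)).boundary M := g.isBoundaryPoint y hy
    have h2 : liftPt g hg y ∈ (𝓡∂ (n + 1)).boundary ↥(coresComplement h) :=
      (mem_boundary_opens_iff (coresComplement h) _).2 h1
    exact (mem_boundary_iff_of_isSmoothEmbedding D.hjA D.hjAo _).2 h2

/-- The lifted attaching map on points. [folklore] -/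
@[simp] theorem lift_apply (y : ↥(handleTube n k)) :
    (D.lift g hg).toFun y = D.jA (liftPt g hg y) := rfl

/-- **The attaching sphere of the lifted map is `jA(ḡ(S))`**: membership. [folklore] -/
theorem mem_core_lift_iff {p : P₁} :
    p ∈ (D.lift g hg).core ↔ ∃ y : ↥(handleTube n k),
      lamSq k (((y : 𝔻 (n + 1)) : 𝔼 (n + 1))) = 1 ∧ D.jA (liftPt g hg y) = p := by
  rw [mem_core_iff]; rfl

/-- A point `jA a` lies on the lifted attaching sphere iff `a` lies on `ḡ(S)`. [folklore] -/
theorem jA_mem_core_lift_iff (a : ↥(coresComplement h)) :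
    D.jA a ∈ (D.lift g hg).core ↔ (a : M) ∈ g.core := by
  rw [mem_core_lift_iff, mem_core_iff]
  constructor
  · rintro ⟨y, hy, he⟩
    exact ⟨y, hy, by rw [← D.injective_jA he]; rfl⟩
  · rintro ⟨y, hy, he⟩
    exact ⟨y, hy, congrArg D.jA (Subtype.ext he)⟩

omit [IsManifold (𝓡∂ (n + 1)) ∞ M] [IsManifold (𝓡∂ (n + 1)) ∞ P₁] in
/-- **The handles of `P₁` miss the lifted attaching sphere** (indeed they miss `jA(ḡ(T))`: a
common point `jA (ḡ y) = jBᵢ b` would be glued, `ḡ y = h̄ᵢ y'`, contradicting the disjointness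
of the ranges). [folklore] -/
theorem jA_liftPt_ne_jB (y : ↥(handleTube n k)) (i : ι) (b : ↥(beltPiece n k)) :
    D.jA (liftPt g hg y) ≠ D.jB i b := by
  intro he
  obtain ⟨y', -, -, hy'⟩ := (D.glue i _ _).1 he
  exact Set.disjoint_left.1 (hg i) (mem_range_self y)
    (by rw [coe_liftPt] at hy'; rw [hy']; exact mem_range_self y')

/-- The handle points `jBᵢ b` lie off the lifted attaching sphere. [folklore] -/
theorem jB_not_mem_core_lift (i : ι) (b : ↥(beltPiece n k)) :
    D.jB i b ∉ (D.lift g hg).core := by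
  rw [mem_core_lift_iff]
  rintro ⟨y, -, he⟩
  exact D.jA_liftPt_ne_jB g hg y i b he

/-- **The gluing relation of the lifted map at a point `jA a`** is that of `ḡ` at `a`.
[folklore] -/
theorem glueRel_lift_jA_iff (a : ↥(coresComplement h)) (b : 𝔻 (n + 1)) :
    (D.lift g hg).glueRel (D.jA a) b ↔ g.glueRel (a : M) b := by
  constructor
  · rintro ⟨y, hy1, hb, he⟩
    refine ⟨y, hy1, hb, ?_⟩
    rw [lift_apply] at he
    rw [← coe_liftPt g hg y, ← D.injective_jA he]
  · rintro ⟨y, hy1, hb, he⟩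
    exact ⟨y, hy1, hb, congrArg D.jA (Subtype.ext he)⟩

/-- No handle point `jBᵢ b'` is glued to the new handle. [folklore] -/
theorem not_glueRel_lift_jB (i : ι) (b' : ↥(beltPiece n k)) (b : 𝔻 (n + 1)) :
    ¬ (D.lift g hg).glueRel (D.jB i b') b := by
  rintro ⟨y, -, -, he⟩
  exact D.jA_liftPt_ne_jB g hg y i b' he.symm

end MultiAttachmentData

end Lift

/-! ### The family with one more attaching map -/

section ConsFamily

/-- **The family `(ḡ, h̄ᵢ)ᵢ` indexed by `Option ι`**: `none ↦ ḡ`, `some i ↦ h̄ᵢ`. [folklore] -/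
def consFamily (g : HandleAttachingMap n k M) (h : ι → HandleAttachingMap n k M) :
    Option ι → HandleAttachingMap n k M := fun o => o.elim g h

omit [T2Space M] [Finite ι] in
/-- `consFamily g h none = ḡ`. [folklore] -/
@[simp] theorem consFamily_none (g : HandleAttachingMap n k M) (h : ι → HandleAttachingMap n k M) :
    consFamily g h none = g := rfl

omit [T2Space M] [Finite ι] in
/-- `consFamily g h (some i) = h̄ᵢ`. [folklore] -/
@[simp] theorem consFamily_some (g : HandleAttachingMap n k M) (h : ι → HandleAttachingMap n k M)
    (i : ι) : consFamily g h (some i) = h i := rfl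

omit [T2Space M] [Finite ι] in
/-- The extended family has pairwise disjoint ranges when `h̄` has and `ḡ` misses the `h̄ᵢ`.
[folklore] -/
theorem pairwise_disjoint_consFamily {g : HandleAttachingMap n k M}
    (hdisj : Pairwise fun i j => Disjoint (range (h i).toFun) (range (h j).toFun))
    (hg : ∀ i, Disjoint (range g.toFun) (range (h i).toFun)) :
    Pairwise fun o o' => Disjoint (range (consFamily g h o).toFun)
      (range (consFamily g h o').toFun) := by
  rintro (_ | i) (_ | j) hne
  · exact absurd rfl hne
  · exact hg j
  · exact (hg i).symm
  · exact hdisj fun e => hne (congrArg some e)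

/-- **Membership in `M ∖ (ḡ(S) ∪ ⋃ h̄ᵢ(S))`.** [folklore] -/
theorem mem_coresComplement_consFamily_iff {g : HandleAttachingMap n k M} {a : M} :
    a ∈ coresComplement (consFamily g h) ↔ a ∉ g.core ∧ a ∈ coresComplement h := by
  simp only [mem_coresComplement, Option.forall, consFamily_none, consFamily_some]

/-- The inclusion `M ∖ (ḡ(S) ∪ ⋃ h̄ᵢ(S)) ⊆ M ∖ ⋃ h̄ᵢ(S)` on points. [folklore] -/
def consIncl (g : HandleAttachingMap n k M) (h : ι → HandleAttachingMap n k M)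
    (a : ↥(coresComplement (consFamily g h))) : ↥(coresComplement h) :=
  ⟨a, (mem_coresComplement_consFamily_iff.1 a.2).2⟩

/-- The underlying point of `consIncl`. [folklore] -/
@[simp] theorem coe_consIncl (g : HandleAttachingMap n k M) (h : ι → HandleAttachingMap n k M)
    (a : ↥(coresComplement (consFamily g h))) : (consIncl g h a : M) = a := rfl

/-- Points of `M ∖ (ḡ(S) ∪ ⋃ h̄ᵢ(S))` lie off `ḡ(S)`. [folklore] -/
theorem not_mem_core_of_mem_coresComplement_consFamily {g : HandleAttachingMap n k M}
    (a : ↥(coresComplement (consFamily g h))) : (a : M) ∉ g.core :=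
  (mem_coresComplement_consFamily_iff.1 a.2).1

/-- `consIncl` is continuous. [folklore] -/
theorem continuous_consIncl (g : HandleAttachingMap n k M) (h : ι → HandleAttachingMap n k M) :
    Continuous (consIncl g h) :=
  continuous_subtype_val.subtype_mk _

/-- `consIncl` is a topological embedding. [folklore] -/
theorem isEmbedding_consIncl (g : HandleAttachingMap n k M) (h : ι → HandleAttachingMap n k M) :
    Topology.IsEmbedding (consIncl g h) :=
  Topology.IsEmbedding.of_comp (continuous_consIncl g h) continuous_subtype_val
    Topology.IsEmbedding.subtypeVal

/-- The range of `consIncl` is the open set `{x | x ∉ ḡ(S)}`. [folklore] -/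
theorem range_consIncl (g : HandleAttachingMap n k M) (h : ι → HandleAttachingMap n k M) :
    range (consIncl g h) = Subtype.val ⁻¹' (g.core)ᶜ := by
  ext x
  constructor
  · rintro ⟨a, rfl⟩
    exact not_mem_core_of_mem_coresComplement_consFamily a
  · intro hx
    exact ⟨⟨x, mem_coresComplement_consFamily_iff.2 ⟨hx, x.2⟩⟩, Subtype.ext rfl⟩

/-- … hence open. [folklore] -/
theorem isOpen_range_consIncl (g : HandleAttachingMap n k M) (h : ι → HandleAttachingMap n k M) :
    IsOpen (range (consIncl g h)) := by
  rw [range_consIncl]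
  exact g.isClosed_core.isOpen_compl.preimage continuous_subtype_val

end ConsFamily

/-! ### Attaching one more handle to `M ∪_{h̄} (handles)` -/

section Cons

variable [IsManifold (𝓡∂ (n + 1)) ∞ M]
  {P₁ : Type*} [TopologicalSpace P₁] [T2Space P₁] [ChartedSpace (EuclideanHalfSpace (n + 1)) P₁]
  [IsManifold (𝓡∂ (n + 1)) ∞ P₁]

namespace MultiAttachmentData

variable (D : MultiAttachmentData h (𝓡∂ (n + 1)) P₁) (g : HandleAttachingMap n k M)
  (hg : ∀ i, Disjoint (range g.toFun) (range (h i).toFun))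

/-! #### The points of `P₁ ∖ jA(ḡ(S))` coming from `M` and from the old handles -/

/-- `jA` of a point off `ḡ(S)` lies off the lifted attaching sphere. [folklore] -/
theorem jA_consIncl_mem_complement (a : ↥(coresComplement (consFamily g h))) :
    D.jA (consIncl g h a) ∈ (D.lift g hg).complement := by
  rw [mem_complement, D.jA_mem_core_lift_iff g hg]
  exact not_mem_core_of_mem_coresComplement_consFamily a

/-- The point `jA a` of `P₁ ∖ jA(ḡ(S))`, for `a ∈ M ∖ (ḡ(S) ∪ ⋃ h̄ᵢ(S))`. [folklore] -/
def consPtA (a : ↥(coresComplement (consFamily g h))) : ↥((D.lift g hg).complement) :=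
  ⟨D.jA (consIncl g h a), D.jA_consIncl_mem_complement g hg a⟩

/-- The underlying point of `consPtA`. [folklore] -/
@[simp] theorem coe_consPtA (a : ↥(coresComplement (consFamily g h))) :
    (D.consPtA g hg a : P₁) = D.jA (consIncl g h a) := rfl

/-- `consPtA` is continuous. [folklore] -/
theorem continuous_consPtA : Continuous (D.consPtA g hg) :=
  (D.hjA.isEmbedding.continuous.comp (continuous_consIncl g h)).subtype_mk _

/-- `consPtA` is a topological embedding. [folklore] -/
theorem isEmbedding_consPtA : Topology.IsEmbedding (D.consPtA g hg) :=
  Topology.IsEmbedding.of_comp (D.continuous_consPtA g hg) continuous_subtype_val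
    (D.hjA.isEmbedding.comp (isEmbedding_consIncl g h))

/-- The range of `consPtA` is open. [folklore] -/
theorem isOpen_range_consPtA : IsOpen (range (D.consPtA g hg)) := by
  have : range (D.consPtA g hg) = Subtype.val ⁻¹' (D.jA '' range (consIncl g h)) := by
    ext q
    constructor
    · rintro ⟨a, rfl⟩
      exact ⟨consIncl g h a, mem_range_self a, rfl⟩
    · rintro ⟨_, ⟨a, rfl⟩, hq⟩
      exact ⟨a, Subtype.ext hq⟩
  rw [this]
  exact (D.isOpenMap_jA _ (isOpen_range_consIncl g h)).preimage continuous_subtype_val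

/-- **`consPtA` is an immersion at every point** (with the complement of `jA`): read
`a ↦ jA ⟨a, _⟩` as the immersion `jA` precomposed with the inverse of the coercion chart of the
open `M ∖ ⋃ h̄ᵢ(S)` and restricted to the open `M ∖ (ḡ(S) ∪ ⋃ h̄ᵢ(S))`, then corestricted to the
open `P₁ ∖ jA(ḡ(S))`. [folklore] -/
theorem isImmersionAtOfComplement_consPtA {F : Type*} [NormedAddCommGroup F] [NormedSpace ℝ F]
    (hF : ∀ x, Manifold.IsImmersionAtOfComplement F (𝓡∂ (n + 1)) (𝓡∂ (n + 1)) ∞ D.jA x)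
    (a : ↥(coresComplement (consFamily g h))) :
    Manifold.IsImmersionAtOfComplement F (𝓡∂ (n + 1)) (𝓡∂ (n + 1)) ∞ (D.consPtA g hg) a := by
  haveI hne : Nonempty ↥(coresComplement h) := ⟨consIncl g h a⟩
  set c := (coresComplement h).openPartialHomeomorphSubtypeCoe hne with hc
  have hΦ : ContMDiffOn (𝓡∂ (n + 1)) (𝓡∂ (n + 1)) ∞ c.symm c.symm.source :=
    contMDiffOn_openPartialHomeomorphSubtypeCoe_symm (coresComplement h) hne
  have hΦ' : ContMDiffOn (𝓡∂ (n + 1)) (𝓡∂ (n + 1)) ∞ c.symm.symm c.symm.target := by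
    rw [OpenPartialHomeomorph.symm_symm, OpenPartialHomeomorph.symm_target]
    exact contMDiffOn_openPartialHomeomorphSubtypeCoe (coresComplement h) hne
  have hsrc : ((a : M)) ∈ c.symm.source := by
    rw [OpenPartialHomeomorph.symm_source,
      TopologicalSpace.Opens.openPartialHomeomorphSubtypeCoe_target]
    exact (consIncl g h a).2
  -- `jA ∘ c⁻¹ : M ⇀ P₁` is an immersion at `a`
  have h1 : Manifold.IsImmersionAtOfComplement F (𝓡∂ (n + 1)) (𝓡∂ (n + 1)) ∞ (D.jA ∘ c.symm)
      (a : M) :=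
    (hF (c.symm (a : M))).comp_openPartialHomeomorph c.symm hΦ hΦ' hsrc
  -- restrict to the open `M ∖ (ḡ(S) ∪ ⋃ h̄ᵢ(S))`
  have h2 : Manifold.IsImmersionAtOfComplement F (𝓡∂ (n + 1)) (𝓡∂ (n + 1)) ∞
      ((D.jA ∘ c.symm) ∘ Subtype.val : ↥(coresComplement (consFamily g h)) → P₁) a :=
    h1.comp_subtypeVal (coresComplement (consFamily g h))
  have h3 : Manifold.IsImmersionAtOfComplement F (𝓡∂ (n + 1)) (𝓡∂ (n + 1)) ∞
      (fun a' => D.jA (consIncl g h a')) a := by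
    refine h2.congr_of_eventuallyEq (Filter.Eventually.of_forall fun a' => ?_)
    show D.jA (c.symm (a' : M)) = D.jA (consIncl g h a')
    congr 1
    have hmem : consIncl g h a' ∈ c.source := by
      rw [TopologicalSpace.Opens.openPartialHomeomorphSubtypeCoe_source]; exact mem_univ _
    have := c.left_inv hmem
    rw [TopologicalSpace.Opens.openPartialHomeomorphSubtypeCoe_coe] at this
    exact this
  -- corestrict to the open `P₁ ∖ jA(ḡ(S))`
  exact h3.codRestrict_opens (D.lift g hg).complement (D.jA_consIncl_mem_complement g hg)

/-- The point `jBᵢ b` of `P₁ ∖ jA(ḡ(S))`. [folklore] -/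
def consPtB (i : ι) (b : ↥(beltPiece n k)) : ↥((D.lift g hg).complement) :=
  ⟨D.jB i b, D.jB_not_mem_core_lift g hg i b⟩

/-- The underlying point of `consPtB`. [folklore] -/
@[simp] theorem coe_consPtB (i : ι) (b : ↥(beltPiece n k)) :
    (D.consPtB g hg i b : P₁) = D.jB i b := rfl

/-- `consPtBᵢ` is a topological embedding. [folklore] -/
theorem isEmbedding_consPtB (i : ι) : Topology.IsEmbedding (D.consPtB g hg i) :=
  Topology.IsEmbedding.of_comp (((D.hjB i).1.isEmbedding.continuous).subtype_mk _) continuous_subtype_val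
    (D.hjB i).1.isEmbedding

/-- The range of `consPtBᵢ` is open. [folklore] -/
theorem isOpen_range_consPtB (i : ι) : IsOpen (range (D.consPtB g hg i)) := by
  have : range (D.consPtB g hg i) = Subtype.val ⁻¹' range (D.jB i) := by
    ext q
    constructor
    · rintro ⟨b, rfl⟩; exact ⟨b, rfl⟩
    · rintro ⟨b, hb⟩; exact ⟨b, Subtype.ext hb⟩
  rw [this]
  exact (D.hjB i).2.preimage continuous_subtype_val

/-- `consPtBᵢ` is an immersion at every point (with the complement of `jBᵢ`). [folklore] -/
theorem isImmersionAtOfComplement_consPtB {F : Type*} [NormedAddCommGroup F] [NormedSpace ℝ F]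
    (i : ι) (hF : ∀ b, Manifold.IsImmersionAtOfComplement F (𝓡∂ (n + 1)) (𝓡∂ (n + 1)) ∞ (D.jB i) b)
    (b : ↥(beltPiece n k)) :
    Manifold.IsImmersionAtOfComplement F (𝓡∂ (n + 1)) (𝓡∂ (n + 1)) ∞ (D.consPtB g hg i) b :=
  (hF b).codRestrict_opens (D.lift g hg).complement (D.jB_not_mem_core_lift g hg i)

end MultiAttachmentData

variable {P : Type*} [TopologicalSpace P] [ChartedSpace (EuclideanHalfSpace (n + 1)) P]
  {D : MultiAttachmentData h (𝓡∂ (n + 1)) P₁} {g : HandleAttachingMap n k M}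
  {hg : ∀ i, Disjoint (range g.toFun) (range (h i).toFun)}

/-- **Data of the iterated attachment**: data `D` of `P₁ = M ∪_{h̄} (handles)` together with the
witnesses of `P = P₁ ∪ H` attached along the lifted map `jA ∘ ḡ`
(`(D.lift g hg).IsAttachment (𝓡∂ m) P`: the embedding `jA'` of `P₁ ∖ jA(ḡ(S))`, the handle
`jB'`).  Proof-internal packaging for `MultiAttachmentData.isMultiAttachment_cons`. [folklore] -/
structure ConsData (D : MultiAttachmentData h (𝓡∂ (n + 1)) P₁) (g : HandleAttachingMap n k M)
    (hg : ∀ i, Disjoint (range g.toFun) (range (h i).toFun))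
    (P : Type*) [TopologicalSpace P] [ChartedSpace (EuclideanHalfSpace (n + 1)) P] where
  /-- the embedding of `P₁ ∖ jA(ḡ(S))` -/
  jA' : ↥((D.lift g hg).complement) → P
  /-- the new handle -/
  jB' : ↥(beltPiece n k) → P
  /-- `jA'` is a smooth embedding … -/
  hjA' : Manifold.IsSmoothEmbedding (𝓡∂ (n + 1)) (𝓡∂ (n + 1)) ∞ jA'
  /-- … with open range -/
  hjA'o : IsOpen (range jA')
  /-- `jB'` is a smooth embedding … -/
  hjB' : Manifold.IsSmoothEmbedding (𝓡∂ (n + 1)) (𝓡∂ (n + 1)) ∞ jB'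
  /-- … with open range -/
  hjB'o : IsOpen (range jB')
  /-- the two pieces cover `P` -/
  cover' : range jA' ∪ range jB' = univ
  /-- and meet along the gluing relation of the lifted map -/
  glue' : ∀ a b, jA' a = jB' b ↔ (D.lift g hg).glueRel (a : P₁) (b : 𝔻 (n + 1))

namespace ConsData

variable (C : ConsData D g hg P)

/-! #### The new `M`-piece `jA' ∘ jA` -/

/-- **The new embedding of the `M`-piece**: `jA' ∘ jA` on `M ∖ (ḡ(S) ∪ ⋃ h̄ᵢ(S))`. [folklore] -/
def JA : ↥(coresComplement (consFamily g h)) → P := C.jA' ∘ D.consPtA g hg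

/-- `JA` on points. [folklore] -/
theorem JA_apply (a : ↥(coresComplement (consFamily g h))) : C.JA a = C.jA' (D.consPtA g hg a) :=
  rfl

/-- `JA` is an immersion at every point. [folklore] -/
theorem isImmersionAt_JA [IsManifold (𝓡∂ (n + 1)) ∞ P] (a : ↥(coresComplement (consFamily g h))) :
    Manifold.IsImmersionAt (𝓡∂ (n + 1)) (𝓡∂ (n + 1)) ∞ C.JA a := by
  obtain ⟨F, _, _, hF⟩ := D.hjA.isImmersion
  exact ((D.isImmersionAtOfComplement_consPtA g hg hF a).openEmbedding_comp C.hjA'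
    C.hjA'o).isImmersionAt

/-- `JA` is a smooth embedding. [folklore] -/
theorem isSmoothEmbedding_JA [IsManifold (𝓡∂ (n + 1)) ∞ P] :
    Manifold.IsSmoothEmbedding (𝓡∂ (n + 1)) (𝓡∂ (n + 1)) ∞ C.JA :=
  ⟨Manifold.isImmersion_of_isImmersionAt_of_finrank_eq rfl C.isImmersionAt_JA,
    C.hjA'.isEmbedding.comp (D.isEmbedding_consPtA g hg)⟩

/-- `JA` has open range. [folklore] -/
theorem isOpen_range_JA : IsOpen (range C.JA) := by
  rw [JA, range_comp]
  exact (Topology.IsOpenEmbedding.mk C.hjA'.isEmbedding C.hjA'o).isOpenMap _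
    (D.isOpen_range_consPtA g hg)

/-! #### The old handles `jA' ∘ jBᵢ` and the new handle `jB'` -/

/-- **The new handle embeddings**: the old handles through `jA'`, the new one by `jB'`.
[folklore] -/
def JB : Option ι → ↥(beltPiece n k) → P
  | none => C.jB'
  | some i => C.jA' ∘ D.consPtB g hg i

/-- `JB none = jB'`. [folklore] -/
@[simp] theorem JB_none : C.JB none = C.jB' := rfl

/-- `JB (some i) = jA' ∘ consPtBᵢ`. [folklore] -/
@[simp] theorem JB_some (i : ι) : C.JB (some i) = C.jA' ∘ D.consPtB g hg i := rfl

/-- `jA' ∘ consPtBᵢ` is an immersion at every point. [folklore] -/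
theorem isImmersionAt_JB_some [IsManifold (𝓡∂ (n + 1)) ∞ P] (i : ι) (b : ↥(beltPiece n k)) :
    Manifold.IsImmersionAt (𝓡∂ (n + 1)) (𝓡∂ (n + 1)) ∞ (C.JB (some i)) b := by
  obtain ⟨F, _, _, hF⟩ := (D.hjB i).1.isImmersion
  exact ((D.isImmersionAtOfComplement_consPtB g hg i hF b).openEmbedding_comp C.hjA'
    C.hjA'o).isImmersionAt

/-- The new handle embeddings are smooth embeddings with open ranges. [folklore] -/
theorem isSmoothEmbedding_JB [IsManifold (𝓡∂ (n + 1)) ∞ P] (o : Option ι) :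
    Manifold.IsSmoothEmbedding (𝓡∂ (n + 1)) (𝓡∂ (n + 1)) ∞ (C.JB o) ∧
      IsOpen (range (C.JB o)) := by
  cases o with
  | none => exact ⟨C.hjB', C.hjB'o⟩
  | some i =>
    refine ⟨⟨Manifold.isImmersion_of_isImmersionAt_of_finrank_eq rfl (C.isImmersionAt_JB_some i),
      C.hjA'.isEmbedding.comp (D.isEmbedding_consPtB g hg i)⟩, ?_⟩
    rw [JB_some, range_comp]
    exact (Topology.IsOpenEmbedding.mk C.hjA'.isEmbedding C.hjA'o).isOpenMap _
      (D.isOpen_range_consPtB g hg i)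

/-! #### Cover, gluing relations, disjointness -/

/-- **The new pieces cover `P`.** [folklore] -/
theorem cover_cons : range C.JA ∪ (⋃ o, range (C.JB o)) = univ := by
  refine eq_univ_of_forall fun p => ?_
  rcases (eq_univ_iff_forall.1 C.cover') p with ⟨q, rfl⟩ | ⟨b, rfl⟩
  · -- `p = jA' q`, `q ∈ P₁ ∖ jA(ḡ(S))`: `q = jA a` with `a ∉ ḡ(S)`, or `q = jBᵢ b`
    rcases D.mem_range_or (q : P₁) with ⟨a, ha⟩ | ⟨i, b, hb⟩
    · have hag : (a : M) ∉ g.core := by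
        rw [← D.jA_mem_core_lift_iff g hg, ha]; exact q.2
      refine Or.inl ⟨⟨a, mem_coresComplement_consFamily_iff.2 ⟨hag, a.2⟩⟩, ?_⟩
      rw [JA_apply]
      congr 1
      exact Subtype.ext ha
    · refine Or.inr (mem_iUnion.2 ⟨some i, b, ?_⟩)
      rw [JB_some, comp_apply]
      congr 1
      exact Subtype.ext hb
  · exact Or.inr (mem_iUnion.2 ⟨none, b, rfl⟩)

/-- **The gluing relations of the new presentation.** [folklore] -/
theorem glue_cons (o : Option ι) (a : ↥(coresComplement (consFamily g h)))
    (b : ↥(beltPiece n k)) :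
    C.JA a = C.JB o b ↔ (consFamily g h o).glueRel (a : M) (b : 𝔻 (n + 1)) := by
  cases o with
  | none =>
    rw [JB_none, JA_apply, C.glue', consFamily_none, MultiAttachmentData.coe_consPtA]
    exact D.glueRel_lift_jA_iff g hg _ _
  | some i =>
    rw [JB_some, JA_apply, comp_apply, C.hjA'.isEmbedding.injective.eq_iff, consFamily_some]
    exact ⟨fun e => (D.glue i (consIncl g h a) b).1 (congrArg Subtype.val e),
      fun e => Subtype.ext ((D.glue i (consIncl g h a) b).2 e)⟩

/-- **The new handles are pairwise disjoint.** [folklore] -/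
theorem disjointB_cons : Pairwise fun o o' => Disjoint (range (C.JB o)) (range (C.JB o')) := by
  have key : ∀ i, Disjoint (range (C.JB none)) (range (C.JB (some i))) := fun i => by
    refine Set.disjoint_left.2 ?_
    rintro _ ⟨b, rfl⟩ ⟨b', he⟩
    rw [JB_some, comp_apply, JB_none] at he
    exact D.not_glueRel_lift_jB g hg i b' (b : 𝔻 (n + 1)) ((C.glue' _ _).1 he)
  rintro (_ | i) (_ | j) hne
  · exact absurd rfl hne
  · exact key j
  · exact (key i).symm
  · have hij : i ≠ j := fun e => hne (congrArg some e)
    refine Set.disjoint_left.2 ?_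
    rintro _ ⟨b, rfl⟩ ⟨b', he⟩
    rw [JB_some, JB_some, comp_apply, comp_apply, C.hjA'.isEmbedding.injective.eq_iff] at he
    have he' : D.jB j b' = D.jB i b := congrArg Subtype.val he
    exact Set.disjoint_left.1 (D.disjointB hij) (mem_range_self b) ⟨b', he'⟩

/-- **The simultaneous attachment assembled from the iterated one.** [cite: Kosinski1993, VI (7.1)] -/
theorem isMultiAttachment [IsManifold (𝓡∂ (n + 1)) ∞ P] (C : ConsData D g hg P) :
    IsMultiAttachment (consFamily g h) (𝓡∂ (n + 1)) P :=
  ⟨pairwise_disjoint_consFamily D.disjoint hg, C.JA, C.JB, C.isSmoothEmbedding_JA,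
    C.isOpen_range_JA, C.isSmoothEmbedding_JB, C.cover_cons, C.glue_cons, C.disjointB_cons⟩

end ConsData

/-- **Re-association: attaching one more handle to `M ∪_{h̄} (handles)` is attaching all the
handles to `M` at once** (Kosinski 1993, VI (7.1); VII, proof of (1.2)).  Let `D` be data
exhibiting `P₁` as `M` with handles attached along the `h̄ᵢ`, let `ḡ` be an attaching map of
`M` whose range misses the ranges of the `h̄ᵢ`, and let `P` be `P₁` with a handle attached
along the lifted map `jA ∘ ḡ` (`MultiAttachmentData.lift`).  Then `P` is `M` with handles
attached simultaneously along the family `(ḡ, h̄ᵢ)ᵢ` (`consFamily g h`).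
[cite: Kosinski1993, VI (7.1)] -/
theorem MultiAttachmentData.isMultiAttachment_cons [IsManifold (𝓡∂ (n + 1)) ∞ P]
    (D : MultiAttachmentData h (𝓡∂ (n + 1)) P₁) (g : HandleAttachingMap n k M)
    (hg : ∀ i, Disjoint (range g.toFun) (range (h i).toFun))
    (hP : (D.lift g hg).IsAttachment (𝓡∂ (n + 1)) P) :
    IsMultiAttachment (consFamily g h) (𝓡∂ (n + 1)) P := by
  obtain ⟨jA', jB', hjA', hjA'o, hjB', hjB'o, hcov', hglue'⟩ := hP
  exact ConsData.isMultiAttachment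
    ({ jA' := jA', jB' := jB', hjA' := hjA', hjA'o := hjA'o, hjB' := hjB', hjB'o := hjB'o,
       cover' := hcov', glue' := hglue' } : ConsData D g hg P)

/-- **Re-association, stated on the predicates**: with the data *chosen* from a
multi-attachment `P₁` of `M` along `h̄` (`IsMultiAttachment.multiAttachmentData`), a further
attachment along the lifted `ḡ` is a simultaneous attachment along `(ḡ, h̄ᵢ)ᵢ`.
[cite: Kosinski1993, VI (7.1)] -/
theorem IsMultiAttachment.cons [IsManifold (𝓡∂ (n + 1)) ∞ P]
    (hP₁ : IsMultiAttachment h (𝓡∂ (n + 1)) P₁) (g : HandleAttachingMap n k M)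
    (hg : ∀ i, Disjoint (range g.toFun) (range (h i).toFun))
    (hP : (hP₁.multiAttachmentData.lift g hg).IsAttachment (𝓡∂ (n + 1)) P) :
    IsMultiAttachment (consFamily g h) (𝓡∂ (n + 1)) P :=
  hP₁.multiAttachmentData.isMultiAttachment_cons g hg hP

/-! #### The converse: a simultaneous attachment is an iterated one -/

omit [IsManifold (𝓡∂ (n + 1)) ∞ M] in
/-- **Transport of a single handle attachment along a diffeomorphism of the attached manifold**
(same attaching map): compose the two open smooth embeddings with the diffeomorphism.
Kosinski VI §1, §6: `M ∪ H^λ` is well defined up to diffeomorphism.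
[cite: Kosinski1993, VI §6] -/
theorem IsAttachment.of_diffeomorph {N : Type*} [TopologicalSpace N] [T2Space N]
    [ChartedSpace (EuclideanHalfSpace (n + 1)) N] {f : HandleAttachingMap n k N}
    {Q Q' : Type*} [TopologicalSpace Q] [ChartedSpace (EuclideanHalfSpace (n + 1)) Q]
    [IsManifold (𝓡∂ (n + 1)) ∞ Q] [TopologicalSpace Q'] [ChartedSpace (EuclideanHalfSpace (n + 1)) Q']
    [IsManifold (𝓡∂ (n + 1)) ∞ Q'] (hQ : f.IsAttachment (𝓡∂ (n + 1)) Q)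
    (e : Q ≃ₘ⟮𝓡∂ (n + 1), 𝓡∂ (n + 1)⟯ Q') : f.IsAttachment (𝓡∂ (n + 1)) Q' := by
  obtain ⟨jA, jB, hjA, hjAo, hjB, hjBo, hcov, hglue⟩ := hQ
  refine ⟨e ∘ jA, e ∘ jB, hjA.diffeomorph_comp e, ?_, hjB.diffeomorph_comp e, ?_, ?_,
    fun a b => ?_⟩
  · rw [range_comp]; exact e.toHomeomorph.isOpenMap _ hjAo
  · rw [range_comp]; exact e.toHomeomorph.isOpenMap _ hjBo
  · rw [range_comp, range_comp, ← image_union, hcov, image_univ]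
    exact e.toEquiv.range_eq_univ
  · rw [← hglue a b]
    exact e.injective.eq_iff

/-- **Re-association, converse: a simultaneous attachment along `(ḡ, h̄ᵢ)ᵢ` is `P₁ ∪ H`
attached along the lifted `ḡ`**, for any data `D` of `P₁ = M ∪_{h̄} (handles)`: take some
attachment `P'` of the lifted map to `P₁` (`HandleAttachingMap.exists_isAttachment_holds`); by
the direct passage it is a simultaneous attachment along `(ḡ, h̄ᵢ)ᵢ`, hence diffeomorphic to `P`
(`IsMultiAttachment.nonempty_diffeomorph`), and the attachment is transported along the
diffeomorphism (`IsAttachment.of_diffeomorph`).  Kosinski VI (7.1): the handles *"can all be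
attached at the same time"* — and conversely one after the other. [cite: Kosinski1993, VI (7.1)] -/
theorem MultiAttachmentData.isAttachment_lift_of_isMultiAttachment_cons
    [SecondCountableTopology P₁] [IsManifold (𝓡∂ (n + 1)) ∞ P]
    (D : MultiAttachmentData h (𝓡∂ (n + 1)) P₁) (g : HandleAttachingMap n k M)
    (hg : ∀ i, Disjoint (range g.toFun) (range (h i).toFun))
    (hP : IsMultiAttachment (consFamily g h) (𝓡∂ (n + 1)) P) :
    (D.lift g hg).IsAttachment (𝓡∂ (n + 1)) P := by
  obtain ⟨P', _, _, _, _, _, -, hP'⟩ := exists_isAttachment_holds n k P₁ (D.lift g hg)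
  have hmulti : IsMultiAttachment (consFamily g h) (𝓡∂ (n + 1)) P' :=
    D.isMultiAttachment_cons g hg hP'
  obtain ⟨e⟩ := hmulti.nonempty_diffeomorph hP
  exact hP'.of_diffeomorph e

/-- **Re-association as an equivalence**: `P` is `P₁` with a handle attached along the lifted
`ḡ` iff `P` is `M` with the handles `(ḡ, h̄ᵢ)ᵢ` attached simultaneously.
[cite: Kosinski1993, VI (7.1)] -/
theorem MultiAttachmentData.isAttachment_lift_iff [SecondCountableTopology P₁]
    [IsManifold (𝓡∂ (n + 1)) ∞ P] (D : MultiAttachmentData h (𝓡∂ (n + 1)) P₁)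
    (g : HandleAttachingMap n k M) (hg : ∀ i, Disjoint (range g.toFun) (range (h i).toFun)) :
    (D.lift g hg).IsAttachment (𝓡∂ (n + 1)) P ↔
      IsMultiAttachment (consFamily g h) (𝓡∂ (n + 1)) P :=
  ⟨D.isMultiAttachment_cons g hg, D.isAttachment_lift_of_isMultiAttachment_cons g hg⟩

end Cons

end HandleAttachingMap

end Literature.Topology.FourManifolds

end
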